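import Summits.QuantumFields.BalabanUV.T4Continuum.Support.B13AssemblyCoresEndSubstrate
import Summits.QuantumFields.BalabanUV.T4Continuum.Support.B13StepEndInsOpBalaban
import Summits.QuantumFields.BalabanUV.T4Continuum.Support.SubstrateO1Readings

/-!
# B13AssemblyCoresEndSubstrateBalaban — NE5 ∕ U3: THE END OF RECORD WITH (2.14) FACTOR CORES READ AT BAŁABAN's TIER-B BACKGROUND, STATED
# AT THE SUBSTRATE's O1 INSTANCE `SubstrateSlotsOfRecord.slotsOfRecord …` (substrate-p1, p220104; MAP §O1 O-8) ON THE MEASURABLE OPERATOR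
# CARRIER OF RECORD `measOp` — W1 supplied by substrate-p1's `SubstrateO1Readings` (p225064) BY NAME, the arithmetic letters ELIMINATED
# (this lineage's `B13AssemblyCoresEndSubstrate` §2, p222947, over `B13AssemblyCoresEndRestrictRecord` §3, p221018) BY NAME; per two-run object and η-UNIFORMLY

Cell `pub-balaban`, unit `b2b-balaban-t4-ne5-formalise-leaf-08` (NE5 formalisation swarm, LEAF PROVER 08, gen 10; the (2.14)-CORES ROAD lineage;
typer `t4/formal/NE5/LEAVES.md` v2.6 CLAIM RULE 7 (b) ∕ CLAIM RULE 1: a landed END face APPLIED BY NAME at the substrate's O1 instance in a NEW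
`Support/B13*` module — precedents `B13AssemblyCoresEndRestrictRecord`∕`…Substrate` (this lineage), `B13StepOfRecordSubstrate` (E8[rec] road,
leaf-01-g11), `B13StepEnvelopeEndSubstrate` (E9[rec] road, leaf-03-g11), `B13StepEndInsOpSubstrate` (E1-insOp road, leaf-10-g9, p226898 — THE
TEMPLATE of this file); journal INTENT `HOME/CLAIMS.log`).  THE CORES-ROAD TWIN of leaf-10-g9's `B13StepEndInsOpSubstrate`.  Imports this
lineage's `B13AssemblyCoresEndSubstrate`, leaf-10-g8's `B13StepEndInsOpBalaban` (for `sqrt_rate_pos_lt_one` ∕ `c1_balaban_nonneg` BY NAME) and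
substrate-p1's `SubstrateO1Readings` ONLY; edits nothing; defines NO species reading (owner RULING R41) and constructs ∕ discharges NOTHING of the
instance (DESIGN RULE R34) beyond the by-name readings listed below.  Summits-side new work under the LEAN PLACEMENT RULE (bookkeeping; 0 `def`,
0 cite tags — printed KIND only).  HONEST FRAMING: rung (B)+1 of the FINITE-VOLUME T⁴ continuum programme — NOT infinite volume, NOT a mass gap,
NOT the Clay problem, and **NOT A PROOF OF NE5** (NOT PRINTED: the series prints ε-UNIFORM bounds, never η-RATES; cell GAPS G-t4-U3-1), NOT a proof
of NE2 or NE3: every theorem is an IMPLICATION whose wall binders are DISPLAYED HYPOTHESES — ABOUT THE SUBSTRATE's LETTERS (`SlotLetters`: factor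
letters, weights `W`, contour systems `ΓA ∕ ΓB`, kernel ∕ potential tables `dkA … pRB`, insertion letters `ins`, margins `rOp ∕ rHist`) and the
substrate's (2.14)-cores of record `coresRec` — asserted nowhere; the substrate's instance is NOT claimed to satisfy any of them.  R48 ∕ R49 HONEST
LINE: `slotsOfRecord` is the VALUE-TABLE model (poorer than print at MI-R, [Balaban1988RG2Cluster] Lemma 1 (1.33)); Road D
`OutputRateFunctionalTables*` is of record for MI-R, instance = substrate; VALUE UNCHANGED.  HONEST DEPENDENCY (cell line, verbatim): continuum YM
on T⁴ ⇐ BetaPertH ∧ nine spine estimates (0/9 proved); BetaPertH ⇐ (D1) ∧ (D4) ∧ CAP+tail; G-an2-4 gates asym, D1 and NE2/3/4.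

WHAT THIS FILE DOES (compositions BY NAME; no analytic estimate of its own).  At `S₀ := slotsOfRecord D ιr cc ag sg Pm 𝒵 domZ Jc Vv mI Lsl` two binders
of this lineage's letters-free cores END on `measOp`, `B13AssemblyCoresEndSubstrate.exists_ne5_substrate_cores_actNorm` (p222947 §2), are READ BY
NAME: (i) W1 `hwer` := substrate-p1's `SubstrateO1Readings.weightedEntrywiseRate_slotsOfRecord_balaban_ne3Shape` (the owner's record face
`B13ReadingsRecord.weightedEntrywiseRate_record_balaban_ne3Shape` AT the instance, slot lines `rfl`) — so node U1b's `NE3Shape (minActReadings …) Cn θ`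
(OPEN, row NE3), the (3.35)-class ∕ threshold letters and the owner's O1 reading ∕ decay ∕ Lipschitz ∕ domination letters AT THE SUBSTRATE's TABLES
are displayed instead, input rate `Θ := √(max θ L⁻¹)`; (ii) `hc₁ ∕ hθ0 ∕ hθ1` := p225077 §1 (`c1_balaban_nonneg`, `sqrt_rate_pos_lt_one …
hNE3.rate_lt_one`).  W4 is displayed AT `Θ`; EVERY OTHER binder of p222947 §2 is displayed VERBATIM (p221190's six letter conditions `hbdA … hmRB`
and factorisation datum `(iopAt, hiopA)`; W3 slice budgets ×2; L05∕L06 of the instance's outputs; `RawBounded` ×2 + floor; rooms; the FACTOR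
operator letters of the substrate's cores `coresRec` on the `measOp`-balls about run B's datum of record; the history radius; the stripped
majorant `A′` with its decay split and the anchored exponential norm `Φ′ < 1∕36`; sizes; the TWO STRICT SIZE INEQUALITIES).
* §1 **`exists_ne5_of_substrate_cores_balaban_ne3Shape`** — PER TWO-RUN OBJECT `D : DrivenRuns G` and letter package `Lsl`: conclusion LITERALLY
  `∃ C₅, T4OutputRate.NE5 (B13StepOfRecord.outA (slotsOfRecord …) E₀ cB) (B13StepOfRecord.outB (slotsOfRecord …) E₀ cB) W κ θ′ C₅` at the PRESCRIBED `θ′`.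
* §2 **`uniform_ne5_of_substrate_cores_balaban_ne3Shape`** — ONE `C₅` from the SIZES ONLY (`κ` aside: `Φ′, EA₀, E₀, cA, cB, r₀, δ′, θ′, ω`, W1's
  constant letters `o, d, L, a, α, β, Cn, a′, B₁, B₂, B₃, Λ₂, …, Λ₅`, U1b's `θ < 1`) for EVERY gauge group, driven two-run object `D`, representation
  `ιr`, letters `cc ag sg`, frame `Pm`, factor index data, EVERY letter package `Lsl` with `Lsl.ins.ω = ω`, its letter conditions and factorisation
  datum, admissible data `dom ∕ 𝒞 ∕ N ∕ RgV` in U1b's shape at `(Cn, θ)`, towers, O1 letters, window, factor letters `m⋆, mf, bf, N₀f`, `H`, `A′` —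
  built on this lineage's EXPLICIT-CONSTANT face `B13AssemblyCoresEndSubstrate.ne5_substrate_cores_actNorm` (p222947 §1) with the reach letters
  `ρ₀, k₀, B` CHOSEN FROM THE SIZES before the data (leaf-10's `reach_elim_iff` ∕ `reach_binders_exists` ∕ `smallness_of_gain` BY NAME, gain
  `G := Φ′∕(1 − 36Φ′)`): the η-UNIFORMITY is the quantifier order `∃ C₅, ∀ D … Lsl …`.
CENSUS vs p222947 §2 (binders, by name): MINUS = [hwer, hc₁, hθ0, hθ1]; PLUS = [hL hd hreg hα hβ hC hNE3 ha′ hαη hβη hη, tow, the O1 letters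
hdec hcovA hcovB hdom₁ hΦ hΛ₂ hS₂ hdecΦ hΔA hΔB hdom₂ hΨ hΛ₃ hS₃ hdecΨ hΓA hΓB hdom₃ hΛ₄ hΛ₅ hQ hR]; `θ ↦ √(max θ L⁻¹)` in `hins` ∕ `hθθ′`; the
factor-mass decay split is renamed `hdecM`; rest IDENTICAL.  So at the substrate's O1 instance the terminal (2.14)-cores face displays ONLY `NE3Shape` +
class ∕ threshold + O1 letters at the substrate's tables + letter conditions + factorisation datum + W3 ×2 + L05∕L06 + `RawBounded` ×2 + floor +
W4 at `Θ` + the FACTOR operator letters of `coresRec` (W2-op relocated to factor level, GAPS G-ne5p1-1′∕1″, NOT PRINTED) + history radius + `A′`-decay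
split + `Φ′` + rooms ∕ signs + the two strict size inequalities `cA(EA₀ + E₀) < 1 − ω`, `ω + (Φ′∕(1 − 36Φ′))·cA·(1 − ω)∕(1 − ω − cA(EA₀ + E₀)) < θ′`
— no `hwer`, no rate binder, no `ρ₀ ∕ k₀ ∕ B`, no slot line, no `TransportReads`.  Headline wording (trigger c5 ∕ referee INFO-38): «END ⇐ instance
letters», never «leaf instantiated»; 0∕12 leaves on Bałaban's concrete objects; spine 0∕9.  `FlowStep.BetaPertH`, (B), (B^μ) do not occur.
0 sorry; axioms ⊆ {propext, Classical.choice, Quot.sound}.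
-/

noncomputable section

open scoped BigOperators Matrix.Norms.L2Operator
open Metric Set

namespace Summit.QuantumFields.BalabanUV.T4Continuum.B13AssemblyCoresEndSubstrateBalaban

open _root_.MeasureTheory
open Literature.MathematicalPhysics.QuantumFieldTheory.Balaban1983to89
open Literature.MathematicalPhysics.QuantumFieldTheory.Balaban1983to89.T4OutputRate (DecayBound NE5)
open Literature.MathematicalPhysics.QuantumFieldTheory.Balaban1983to89.B5Prop11Plancherel (Tor fine)
open Literature.MathematicalPhysics.QuantumFieldTheory.Balaban1983to89.B5G183RateUnitTower (lev lev_neZero)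
open Literature.MathematicalPhysics.QuantumFieldTheory.Balaban1983to89.T4EtaRateMin (NE3Shape)
open Summit.QuantumFields.BalabanUV.T4Continuum
open Summit.QuantumFields.BalabanUV.T4Continuum.B13OpDatum
open Summit.QuantumFields.BalabanUV.T4Continuum.B13OpDatumJunctions (opOf RawBounded WeightedEntrywiseRate)
open Summit.QuantumFields.BalabanUV.T4Continuum.B13OpMeasurable (measOp)
open Summit.QuantumFields.BalabanUV.T4Continuum.B13StepTermLabels (InnerLabel)
open Summit.QuantumFields.BalabanUV.T4Continuum.B13InnerData (Bnd b13InnerData)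
open Summit.QuantumFields.BalabanUV.T4Continuum.B13HistMeasurable (MeasPotFrame B13HistM)
open Summit.QuantumFields.BalabanUV.T4Continuum.B13TermCoreFamily (factorCores)
open Summit.QuantumFields.BalabanUV.T4Continuum.B13TermCoreMass (factorMass)
open Summit.QuantumFields.BalabanUV.T4Continuum.UrsellTreeSum (ind)
open Summit.QuantumFields.BalabanUV.T4Continuum.UrsellTermBudget (actSum)
open Summit.QuantumFields.BalabanUV.T4Continuum.B13DomainGeometryTR (SCube footprint)
open Summit.QuantumFields.BalabanUV.T4Continuum.B13StepOfRecord (assembly step outA outB)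
open Summit.QuantumFields.BalabanUV.T4Continuum.B13AssemblyCoresEndRestrictRecord (coresRec)
open Summit.QuantumFields.BalabanUV.T4Continuum.B13AssemblyCoresEndSubstrate (ne5_substrate_cores_actNorm exists_ne5_substrate_cores_actNorm)
open Summit.QuantumFields.BalabanUV.T4Continuum.B13StepOfRecordSubstrate (opB_mem_measOp_slotsOfRecord)
open Summit.QuantumFields.BalabanUV.T4Continuum.B13StepEndArithmetic (reach_elim_iff smallness_of_gain)
open Summit.QuantumFields.BalabanUV.T4Continuum.OutputRateArithmetic (reach_binders_exists)
open Summit.QuantumFields.BalabanUV.T4Continuum.B13StepEndInsOpBalaban (sqrt_rate_pos_lt_one c1_balaban_nonneg)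
open Summit.QuantumFields.BalabanUV.T4Continuum.B13ReadingsDecay (ReadsTowerCovA ReadsTowerCovB CovWeightDominatesDist)
open Summit.QuantumFields.BalabanUV.T4Continuum.B13ReadingsImage
open Summit.QuantumFields.BalabanUV.T4Continuum.B13ReadingsLocal (PotQLipschitzReading PotRLipschitzReading)
open Summit.QuantumFields.BalabanUV.T4Continuum.B13ReadingsAssembly (CpertRec)
open Summit.QuantumFields.BalabanUV.T4Continuum.SubstrateO1Readings (weightedEntrywiseRate_slotsOfRecord_balaban_ne3Shape)
open Summit.QuantumFields.BalabanUV.T4Continuum.DecayRateInterpolation (EntryDecay)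
open Summit.QuantumFields.BalabanUV.T4Continuum.SubstrateBackgroundTransporters (unitMod)
open Summit.QuantumFields.BalabanUV.T4Continuum.SubstrateTwoRunsDriven (DrivenRuns)
open Summit.QuantumFields.BalabanUV.T4Continuum.SubstrateRawSpecies
open Summit.QuantumFields.BalabanUV.T4Continuum.SubstrateSlotsOfRecord
open Summit.QuantumFields.BalabanUV.T4Continuum.BalabanAveragedTowerUnit (idx)
open Summit.QuantumFields.BalabanUV.T4Continuum.GaugeTermScalarData (QuT Q1)
open Summit.QuantumFields.BalabanUV.T4Continuum.RegularSiteTransporters (siteT)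
open Summit.QuantumFields.BalabanUV.T4Continuum.RegularBackgroundTower (RegularTransporters)
open Summit.QuantumFields.BalabanUV.T4Continuum.NE2ColourPerturbedLayer (pertCovC)
open Summit.QuantumFields.BalabanUV.T4Continuum.NE2BalabanRoot (balabanPert)
open Summit.QuantumFields.BalabanUV.T4Continuum.NE2BalabanGauge (gaugeSlot liftR)
open Summit.QuantumFields.BalabanUV.T4Continuum.NE2BalabanThreshold (etaStar)
open Summit.QuantumFields.BalabanUV.T4Continuum.NE2FromNE3Carrier (ne2Loc)
open Summit.QuantumFields.BalabanUV.T4Continuum.MinimalActionRate (minActReadings)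

/-! ## §1 The cores END of record at Bałaban's tier-B background, STATED AT THE SUBSTRATE's O1 INSTANCE on `measOp` -/

section Instance

-- the substrate's telescope for `slotsOfRecord` (p220104 §SlotsRecord; letter names as in `SubstrateO1Readings` ∕ p226898)
variable {𝔾 : Type} [GaugeGroup 𝔾] (D : DrivenRuns 𝔾)
variable {oc : Type} [Fintype oc] [DecidableEq oc] (ιr : 𝔾 →* Matrix oc oc ℂ) (cc : ℂ) (ag : ℝ) (sg : ℕ → ℂ)
variable {T ι' Sy Ω 𝒴 : Type} [MeasurableSpace Ω] (Pm : MeasPotFrame D.carriers) {IOp : Type*}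
  (𝒵 : D.carriers.Dom → InnerLabel D.carriers.Dom (Bnd D.toTwoRuns) → Type) [∀ Z j, Fintype (𝒵 Z j)] (domZ : ∀ Z j, 𝒵 Z j → D.carriers.Dom)
  (Jc : D.carriers.Dom → InnerLabel D.carriers.Dom (Bnd D.toTwoRuns) → Type) [∀ Z j, Fintype (Jc Z j)]
  (Vv : D.carriers.Dom → InnerLabel D.carriers.Dom (Bnd D.toTwoRuns) → Type) [∀ Z j, NormedAddCommGroup (Vv Z j)]
  [∀ Z j, InnerProductSpace ℝ (Vv Z j)] [∀ Z j, MeasurableSpace (Vv Z j)] [∀ Z j, BorelSpace (Vv Z j)] [∀ Z j, FiniteDimensional ℝ (Vv Z j)]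
  (mI : D.carriers.Dom → InnerLabel D.carriers.Dom (Bnd D.toTwoRuns) → Type) [∀ Z j, Fintype (mI Z j)] [∀ Z j, DecidableEq (mI Z j)]
  (Lsl : SlotLetters D (o := oc) (T := T) (ι' := ι') (S := Sy) (Ω := Ω) (𝒴 := 𝒴) Pm (IOp := IOp) 𝒵 domZ Jc Vv mI)
-- node NE3 ∕ the owner's letters (sizes)
variable {d : ℕ} (L : ℕ) [NeZero L] (M : Fin d → ℕ) [hM : ∀ μ, NeZero (M μ)] (a : ℝ) (ha : 0 < a)
variable {o : Type*} [Fintype o] [DecidableEq o] {α β C a' η : ℝ} {m : Type*} [Fintype m] [DecidableEq m]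

/-- [folklore] **THE END OF RECORD WITH (2.14) FACTOR CORES, W1 PRODUCED AT BAŁABAN's TIER-B BACKGROUND, ARITHMETIC LETTERS ELIMINATED — AT THE
SUBSTRATE's O1 INSTANCE ON `measOp`** `S₀ := slotsOfRecord D ιr cc ag sg Pm 𝒵 domZ Jc Vv mI Lsl`: this lineage's
`B13AssemblyCoresEndSubstrate.exists_ne5_substrate_cores_actNorm` with `hwer` SUPPLIED BY NAME by substrate-p1's
`weightedEntrywiseRate_slotsOfRecord_balaban_ne3Shape` (U1b's `NE3Shape` (OPEN), the class ∕ threshold letters `hreg hα hβ hC ha' hαη hβη hη` and the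
owner's O1 letters AT THE SUBSTRATE's TABLES `hdec … hR` displayed instead; run A read THROUGH THE TRANSPORTER), `hc₁ ∕ hθ0 ∕ hθ1` discharged
(p225077 §1), W4 displayed at the input rate `√(max θ L⁻¹)`; p221190's letter conditions `hbdA … hmRB` and factorisation datum `(iopAt, hiopA)`,
margins and age damping read off the letters (`Lsl.rOp`, `Lsl.rHist`, `Lsl.ins.ω`); EVERY OTHER binder of p222947 §2 VERBATIM at the instance.
Conclusion LITERALLY `∃ C₅, T4OutputRate.NE5 (B13StepOfRecord.outA (slotsOfRecord …) E₀ cB) (B13StepOfRecord.outB (slotsOfRecord …) E₀ cB) W κ θ′ C₅`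
at the PRESCRIBED `θ′`.  NOT a proof of NE5 ∕ NE2 ∕ NE3: an implication from displayed binders about the substrate's letters; nothing of
Bałaban's is asserted. -/
theorem exists_ne5_of_substrate_cores_balaban_ne3Shape
    -- p221190 §1's letter conditions (the `measOp` memberships) and §2's factorisation datum (L01)
    (hbdA : ∀ (g : ℕ → ℝ) (U : D.carriers.BgA) (k : ℕ),
      FormatBounded (Lsl.W k).format (rawAOfRecord ιr D cc ag sg Lsl.ΓA Lsl.dkA Lsl.gcA Lsl.pQA Lsl.pRA g U k).kernel)
    (hmQA : ∀ (r : ℝ) (U : GaugeField (D.F.P D.K) 0 𝔾) (k : ℕ) (Y : 𝒴) (b b' : ((Tor (unitMod (D.F.P D.K)) × Fin (D.F.P D.K).d) × oc)),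
      Measurable fun x : Ω => Lsl.pQA r U k x Y b b')
    (hmRA : ∀ (r : ℝ) (U : GaugeField (D.F.P D.K) 0 𝔾) (k : ℕ) (Y : 𝒴), Measurable fun x : Ω => Lsl.pRA r U k x Y)
    (hbdB : ∀ (g : ℕ → ℝ) (U : D.carriers.BgB) (k : ℕ),
      FormatBounded (Lsl.W k).format (rawBOfRecord ιr D cc ag sg Lsl.ΓB Lsl.dkB Lsl.gcB Lsl.pQB Lsl.pRB g U k).kernel)
    (hmQB : ∀ (r : ℝ) (U : GaugeField (D.F.P (D.K + 1)) 0 𝔾) (k : ℕ) (Y : 𝒴) (b b' : ((Tor (unitMod (D.F.P D.K)) × Fin (D.F.P D.K).d) × oc)),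
      Measurable fun x : Ω => Lsl.pQB r U k x Y b b')
    (hmRB : ∀ (r : ℝ) (U : GaugeField (D.F.P (D.K + 1)) 0 𝔾) (k : ℕ) (Y : 𝒴), Measurable fun x : Ω => Lsl.pRB r U k x Y)
    (iopAt : ℝ → D.carriers.BgA → ℕ → IOp)
    (hiopA : ∀ (r : ℝ) (U : D.carriers.BgB) (k : ℕ), Lsl.ins.iopA r U k = iopAt r (D.carriers.transport U) k) (E₀ cB : ℝ)
    -- node U1b's shape, the (3.35)-class, the threshold
    {𝒞 : ℕ → Set (B7Prop1Explicit.Site d → Fin d → (Matrix o o ℂ)ˣ)} {N : ℕ}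
    {dom : Set (B7Prop1Explicit.Site d → Fin d → (Matrix o o ℂ)ˣ)} (hL : 2 ≤ L) (hd : 1 ≤ d)
    {RgV : (B7Prop1Explicit.Site d → Fin d → (Matrix o o ℂ)ˣ) → ((k : ℕ) → Fin d → (Tor (fine (lev L k) M) → Matrix o o ℂ))}
    (hreg : ∀ V ∈ dom, RegularTransporters L M (liftR L M (RgV V)) α β) (hα : 0 ≤ α) (hβ : 0 ≤ β) (hC : 0 ≤ C) {θ : ℝ}
    (hNE3 : NE3Shape (minActReadings d 𝒞 L N dom (ne2Loc L M fun V => liftR L M (RgV V))) C θ)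
    (ha' : 0 < a') (hαη : α ≤ η) (hβη : β ≤ η) (hη : η ≤ etaStar o d a a')
    -- the towers over the two-run object's run-B backgrounds and the window
    {tow : ℕ → (ℕ → ℝ) → D.toTwoRuns.carriers.BgB → ↥dom} {W : Set (ℕ → ℝ)}
    -- the covariance species, read at the substrate's V1 operator entries
    {σ : T → ((Tor (unitMod (D.F.P D.K)) × Fin (D.F.P D.K).d) × oc) → idx L M 0 × o} {dist₁ : idx L M 0 × o → idx L M 0 × o → ℝ} {B₁ δ₁ : ℝ}
    (hdec : ∀ V ∈ dom, ∀ k, EntryDecay dist₁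
      (pertCovC L M a ha (balabanPert L M a (liftR L M (RgV V)) (gaugeSlot L M (RgV V) (QuT L M o (siteT L M (RgV V))) (Q1 L M o) a'))
        1 k) B₁ δ₁)
    (hcovA : ReadsTowerCovA
      (fun V : ↥dom => pertCovC L M a ha
        (balabanPert L M a (liftR L M (RgV V)) (gaugeSlot L M (RgV V) (QuT L M o (siteT L M (RgV V))) (Q1 L M o) a')) 1)
      σ tow (fun g U k => (rawAOfRecord ιr D cc ag sg Lsl.ΓA Lsl.dkA Lsl.gcA Lsl.pQA Lsl.pRA) g (D.toTwoRuns.carriers.transport U) k) W)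
    (hcovB : ReadsTowerCovB
      (fun V : ↥dom => pertCovC L M a ha
        (balabanPert L M a (liftR L M (RgV V)) (gaugeSlot L M (RgV V) (QuT L M o (siteT L M (RgV V))) (Q1 L M o) a')) 1)
      σ tow (rawBOfRecord ιr D cc ag sg Lsl.ΓB Lsl.dkB Lsl.gcB Lsl.pQB Lsl.pRB) W)
    (hdom₁ : CovWeightDominatesDist (slotsOfRecord D ιr cc ag sg Pm 𝒵 domZ Jc Vv mI Lsl).F dist₁ σ (δ₁ / 2))
    -- the `deltaKer` species
    {S₂ : Set (Matrix (idx L M 0 × o) (idx L M 0 × o) ℂ)} {Φ : T → Matrix (idx L M 0 × o) (idx L M 0 × o) ℂ → Matrix m m ℂ}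
    {Λ₂ : ℝ} (hΦ : ∀ t, OpLipschitzOn S₂ (Φ t) Λ₂) (hΛ₂ : 0 ≤ Λ₂)
    (hS₂ : ∀ V ∈ dom, ∀ k, pertCovC L M a ha
      (balabanPert L M a (liftR L M (RgV V)) (gaugeSlot L M (RgV V) (QuT L M o (siteT L M (RgV V))) (Q1 L M o) a')) 1 k ∈ S₂)
    {dist₂ : m → m → ℝ} {B₂ δ₂ : ℝ}
    (hdecΦ : ∀ V ∈ dom, ∀ t k, EntryDecay dist₂ (Φ t (pertCovC L M a ha
      (balabanPert L M a (liftR L M (RgV V)) (gaugeSlot L M (RgV V) (QuT L M o (siteT L M (RgV V))) (Q1 L M o) a')) 1 k)) B₂ δ₂)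
    {σX : T → ι' → m}
    (hΔA : ReadsTowerDeltaA (fun (V : ↥dom) t k => Φ t (pertCovC L M a ha
      (balabanPert L M a (liftR L M (RgV V)) (gaugeSlot L M (RgV V) (QuT L M o (siteT L M (RgV V))) (Q1 L M o) a')) 1 k))
      σX tow (fun g U k => (rawAOfRecord ιr D cc ag sg Lsl.ΓA Lsl.dkA Lsl.gcA Lsl.pQA Lsl.pRA) g (D.toTwoRuns.carriers.transport U) k) W)
    (hΔB : ReadsTowerDeltaB (fun (V : ↥dom) t k => Φ t (pertCovC L M a ha
      (balabanPert L M a (liftR L M (RgV V)) (gaugeSlot L M (RgV V) (QuT L M o (siteT L M (RgV V))) (Q1 L M o) a')) 1 k))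
      σX tow (rawBOfRecord ιr D cc ag sg Lsl.ΓB Lsl.dkB Lsl.gcB Lsl.pQB Lsl.pRB) W)
    (hdom₂ : DeltaWeightDominatesDist (slotsOfRecord D ιr cc ag sg Pm 𝒵 domZ Jc Vv mI Lsl).F dist₂ σX (δ₂ / 2))
    -- the `gammaConstituent` species
    {S₃ : Set (Matrix (idx L M 0 × o) (idx L M 0 × o) ℂ)} {Ψ : T → Matrix (idx L M 0 × o) (idx L M 0 × o) ℂ → Matrix m m ℂ}
    {Λ₃ : ℝ} (hΨ : ∀ t, OpLipschitzOn S₃ (Ψ t) Λ₃) (hΛ₃ : 0 ≤ Λ₃)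
    (hS₃ : ∀ V ∈ dom, ∀ k, pertCovC L M a ha
      (balabanPert L M a (liftR L M (RgV V)) (gaugeSlot L M (RgV V) (QuT L M o (siteT L M (RgV V))) (Q1 L M o) a')) 1 k ∈ S₃)
    {dist₃ : m → m → ℝ} {B₃ δ₃ : ℝ}
    (hdecΨ : ∀ V ∈ dom, ∀ t k, EntryDecay dist₃ (Ψ t (pertCovC L M a ha
      (balabanPert L M a (liftR L M (RgV V)) (gaugeSlot L M (RgV V) (QuT L M o (siteT L M (RgV V))) (Q1 L M o) a')) 1 k)) B₃ δ₃)
    {σB : T → ((Tor (unitMod (D.F.P D.K)) × Fin (D.F.P D.K).d) × oc) → m}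
    (hΓA : ReadsTowerGammaA (fun (V : ↥dom) t k => Ψ t (pertCovC L M a ha
      (balabanPert L M a (liftR L M (RgV V)) (gaugeSlot L M (RgV V) (QuT L M o (siteT L M (RgV V))) (Q1 L M o) a')) 1 k))
      σB σX tow (fun g U k => (rawAOfRecord ιr D cc ag sg Lsl.ΓA Lsl.dkA Lsl.gcA Lsl.pQA Lsl.pRA) g (D.toTwoRuns.carriers.transport U) k) W)
    (hΓB : ReadsTowerGammaB (fun (V : ↥dom) t k => Ψ t (pertCovC L M a ha
      (balabanPert L M a (liftR L M (RgV V)) (gaugeSlot L M (RgV V) (QuT L M o (siteT L M (RgV V))) (Q1 L M o) a')) 1 k))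
      σB σX tow (rawBOfRecord ιr D cc ag sg Lsl.ΓB Lsl.dkB Lsl.gcB Lsl.pQB Lsl.pRB) W)
    (hdom₃ : GammaWeightDominatesDist (slotsOfRecord D ιr cc ag sg Pm 𝒵 domZ Jc Vv mI Lsl).F dist₃ σB σX (δ₃ / 2))
    -- the potential species
    {Λ₄ Λ₅ : ℝ} (hΛ₄ : 0 ≤ Λ₄) (hΛ₅ : 0 ≤ Λ₅)
    (hQ : PotQLipschitzReading (minActReadings d 𝒞 L N dom (ne2Loc L M fun V => liftR L M (RgV V))) (slotsOfRecord D ιr cc ag sg Pm 𝒵 domZ Jc Vv mI Lsl).F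
      (fun g U k => (rawAOfRecord ιr D cc ag sg Lsl.ΓA Lsl.dkA Lsl.gcA Lsl.pQA Lsl.pRA) g (D.toTwoRuns.carriers.transport U) k)
      (rawBOfRecord ιr D cc ag sg Lsl.ΓB Lsl.dkB Lsl.gcB Lsl.pQB Lsl.pRB) W Λ₄)
    (hR : PotRLipschitzReading (minActReadings d 𝒞 L N dom (ne2Loc L M fun V => liftR L M (RgV V))) (slotsOfRecord D ιr cc ag sg Pm 𝒵 domZ Jc Vv mI Lsl).F
      (fun g U k => (rawAOfRecord ιr D cc ag sg Lsl.ΓA Lsl.dkA Lsl.gcA Lsl.pQA Lsl.pRA) g (D.toTwoRuns.carriers.transport U) k)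
      (rawBOfRecord ιr D cc ag sg Lsl.ΓB Lsl.dkB Lsl.gcB Lsl.pQB Lsl.pRB) W Λ₅)
    -- the rest of p222947 §2 VERBATIM at the instance (W4 at the input rate; the factor-mass decay split renamed `hdecM`)
    {ROp RHist R' H : ℕ → ℝ} {N₀f mf bf : D.carriers.Dom → InnerLabel D.carriers.Dom (Bnd D.toTwoRuns) → ℝ}
    {A' : ℕ → D.carriers.Dom → InnerLabel D.carriers.Dom (Bnd D.toTwoRuns) → ℝ} {mstar κ Φ' EA₀ cA r₀ δ' θ' : ℝ}
    (hbB : (assembly (slotsOfRecord D ιr cc ag sg Pm 𝒵 domZ Jc Vv mI Lsl)).SliceBudgetB W κ cB)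
    (hbA : (slotsOfRecord D ιr cc ag sg Pm 𝒵 domZ Jc Vv mI Lsl).D.SliceBudget (step (slotsOfRecord D ιr cc ag sg Pm 𝒵 domZ Jc Vv mI Lsl) E₀ cB) W κ cA)
    (hdA : DecayBound (outA (slotsOfRecord D ιr cc ag sg Pm 𝒵 domZ Jc Vv mI Lsl) E₀ cB) W EA₀ κ)
    (hdB : DecayBound (outB (slotsOfRecord D ιr cc ag sg Pm 𝒵 domZ Jc Vv mI Lsl) E₀ cB) W E₀ κ)
    (hRA : RawBounded (slotsOfRecord D ιr cc ag sg Pm 𝒵 domZ Jc Vv mI Lsl).F (assembly (slotsOfRecord D ιr cc ag sg Pm 𝒵 domZ Jc Vv mI Lsl)).rawAt W)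
    (hRB : RawBounded (slotsOfRecord D ιr cc ag sg Pm 𝒵 domZ Jc Vv mI Lsl).F (slotsOfRecord D ιr cc ag sg Pm 𝒵 domZ Jc Vv mI Lsl).rawB W)
    (hfl : ∀ k, r₀ ≤ Lsl.rOp k)
    (hins : (step (slotsOfRecord D ιr cc ag sg Pm 𝒵 domZ Jc Vv mI Lsl) E₀ cB).InsertionRate W κ E₀ δ' (Real.sqrt (max θ ((L : ℝ)⁻¹))))
    (hOp : ∀ k, Lsl.rOp k ≤ ROp k) (hroom : ∀ k, ROp k < R' k)
    (hHist : ∀ k, (assembly (slotsOfRecord D ιr cc ag sg Pm 𝒵 domZ Jc Vv mI Lsl)).bHist E₀ cB k + Lsl.rHist k ≤ RHist k)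
    -- the FACTOR operator letters of the substrate's cores of record on the `measOp`-balls about run B's datum of record
    (hm : 0 < mstar) (hmf : ∀ Z ℓ, mstar ≤ mf Z ℓ) (hN₀ : ∀ Z ℓ, 0 ≤ N₀f Z ℓ)
    (hNf : ∀ k, ∀ g ∈ W, ∀ (U : D.carriers.BgB) (X : D.carriers.Dom), D.carriers.scale X = k →
      ∀ i, (assembly (slotsOfRecord D ιr cc ag sg Pm 𝒵 domZ Jc Vv mI Lsl)).𝒯.Rel k i X →
      ∀ n : Fin ((assembly (slotsOfRecord D ιr cc ag sg Pm 𝒵 domZ Jc Vv mI Lsl)).𝒯.len i + 1),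
      (∀ op ∈ ball (⟨opOf (slotsOfRecord D ιr cc ag sg Pm 𝒵 domZ Jc Vv mI Lsl).F (slotsOfRecord D ιr cc ag sg Pm 𝒵 domZ Jc Vv mI Lsl).rawB g U k,
          opB_mem_measOp_slotsOfRecord D ιr cc ag sg Pm 𝒵 domZ Jc Vv mI Lsl hbdB hmQB hmRB g U k⟩ :
            measOp T ((Tor (unitMod (D.F.P D.K)) × Fin (D.F.P D.K).d) × oc) ι' Ω 𝒴) (R' k),
        AEStronglyMeasurable ((factorCores (assembly (slotsOfRecord D ιr cc ag sg Pm 𝒵 domZ Jc Vv mI Lsl)).𝒯 (coresRec D Pm 𝒵 domZ Jc Vv mI Lsl) i n).N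
          (op : OpDatum _)) (factorCores (assembly (slotsOfRecord D ιr cc ag sg Pm 𝒵 domZ Jc Vv mI Lsl)).𝒯 (coresRec D Pm 𝒵 domZ Jc Vv mI Lsl) i n).lam) ∧
      (∀ p, DifferentiableOn ℂ (fun op : measOp T ((Tor (unitMod (D.F.P D.K)) × Fin (D.F.P D.K).d) × oc) ι' Ω 𝒴 =>
          (factorCores (assembly (slotsOfRecord D ιr cc ag sg Pm 𝒵 domZ Jc Vv mI Lsl)).𝒯 (coresRec D Pm 𝒵 domZ Jc Vv mI Lsl) i n).N (op : OpDatum _) p)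
        (ball (⟨opOf (slotsOfRecord D ιr cc ag sg Pm 𝒵 domZ Jc Vv mI Lsl).F (slotsOfRecord D ιr cc ag sg Pm 𝒵 domZ Jc Vv mI Lsl).rawB g U k,
          opB_mem_measOp_slotsOfRecord D ιr cc ag sg Pm 𝒵 domZ Jc Vv mI Lsl hbdB hmQB hmRB g U k⟩ :
            measOp T ((Tor (unitMod (D.F.P D.K)) × Fin (D.F.P D.K).d) × oc) ι' Ω 𝒴) (R' k))) ∧
      (∀ op ∈ ball (⟨opOf (slotsOfRecord D ιr cc ag sg Pm 𝒵 domZ Jc Vv mI Lsl).F (slotsOfRecord D ιr cc ag sg Pm 𝒵 domZ Jc Vv mI Lsl).rawB g U k,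
          opB_mem_measOp_slotsOfRecord D ιr cc ag sg Pm 𝒵 domZ Jc Vv mI Lsl hbdB hmQB hmRB g U k⟩ :
            measOp T ((Tor (unitMod (D.F.P D.K)) × Fin (D.F.P D.K).d) × oc) ι' Ω 𝒴) (R' k), ∀ p,
        ‖(factorCores (assembly (slotsOfRecord D ιr cc ag sg Pm 𝒵 domZ Jc Vv mI Lsl)).𝒯 (coresRec D Pm 𝒵 domZ Jc Vv mI Lsl) i n).N (op : OpDatum _) p‖ ≤
          N₀f ((assembly (slotsOfRecord D ιr cc ag sg Pm 𝒵 domZ Jc Vv mI Lsl)).𝒯.poly i n)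
            ((assembly (slotsOfRecord D ιr cc ag sg Pm 𝒵 domZ Jc Vv mI Lsl)).𝒯.lab i n)))
    (hqf : ∀ k, ∀ g ∈ W, ∀ (U : D.carriers.BgB) (X : D.carriers.Dom), D.carriers.scale X = k →
      ∀ i, (assembly (slotsOfRecord D ιr cc ag sg Pm 𝒵 domZ Jc Vv mI Lsl)).𝒯.Rel k i X →
      ∀ n : Fin ((assembly (slotsOfRecord D ιr cc ag sg Pm 𝒵 domZ Jc Vv mI Lsl)).𝒯.len i + 1),
      (∀ op ∈ ball (⟨opOf (slotsOfRecord D ιr cc ag sg Pm 𝒵 domZ Jc Vv mI Lsl).F (slotsOfRecord D ιr cc ag sg Pm 𝒵 domZ Jc Vv mI Lsl).rawB g U k,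
          opB_mem_measOp_slotsOfRecord D ιr cc ag sg Pm 𝒵 domZ Jc Vv mI Lsl hbdB hmQB hmRB g U k⟩ :
            measOp T ((Tor (unitMod (D.F.P D.K)) × Fin (D.F.P D.K).d) × oc) ι' Ω 𝒴) (R' k),
        AEStronglyMeasurable (Function.uncurry
          ((factorCores (assembly (slotsOfRecord D ιr cc ag sg Pm 𝒵 domZ Jc Vv mI Lsl)).𝒯 (coresRec D Pm 𝒵 domZ Jc Vv mI Lsl) i n).q (op : OpDatum _)))
          ((factorCores (assembly (slotsOfRecord D ιr cc ag sg Pm 𝒵 domZ Jc Vv mI Lsl)).𝒯 (coresRec D Pm 𝒵 domZ Jc Vv mI Lsl) i n).lam.prod volume)) ∧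
      (∀ p v, DifferentiableOn ℂ (fun op : measOp T ((Tor (unitMod (D.F.P D.K)) × Fin (D.F.P D.K).d) × oc) ι' Ω 𝒴 =>
          (factorCores (assembly (slotsOfRecord D ιr cc ag sg Pm 𝒵 domZ Jc Vv mI Lsl)).𝒯 (coresRec D Pm 𝒵 domZ Jc Vv mI Lsl) i n).q (op : OpDatum _) p v)
        (ball (⟨opOf (slotsOfRecord D ιr cc ag sg Pm 𝒵 domZ Jc Vv mI Lsl).F (slotsOfRecord D ιr cc ag sg Pm 𝒵 domZ Jc Vv mI Lsl).rawB g U k,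
          opB_mem_measOp_slotsOfRecord D ιr cc ag sg Pm 𝒵 domZ Jc Vv mI Lsl hbdB hmQB hmRB g U k⟩ :
            measOp T ((Tor (unitMod (D.F.P D.K)) × Fin (D.F.P D.K).d) × oc) ι' Ω 𝒴) (R' k))) ∧
      (∀ op ∈ ball (⟨opOf (slotsOfRecord D ιr cc ag sg Pm 𝒵 domZ Jc Vv mI Lsl).F (slotsOfRecord D ιr cc ag sg Pm 𝒵 domZ Jc Vv mI Lsl).rawB g U k,
          opB_mem_measOp_slotsOfRecord D ιr cc ag sg Pm 𝒵 domZ Jc Vv mI Lsl hbdB hmQB hmRB g U k⟩ :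
            measOp T ((Tor (unitMod (D.F.P D.K)) × Fin (D.F.P D.K).d) × oc) ι' Ω 𝒴) (R' k), ∀ p v,
        mf ((assembly (slotsOfRecord D ιr cc ag sg Pm 𝒵 domZ Jc Vv mI Lsl)).𝒯.poly i n) ((assembly (slotsOfRecord D ιr cc ag sg Pm 𝒵 domZ Jc Vv mI Lsl)).𝒯.lab i n) *
            ‖v‖ ^ 2 -
          bf ((assembly (slotsOfRecord D ιr cc ag sg Pm 𝒵 domZ Jc Vv mI Lsl)).𝒯.poly i n) ((assembly (slotsOfRecord D ιr cc ag sg Pm 𝒵 domZ Jc Vv mI Lsl)).𝒯.lab i n) ≤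
          ((factorCores (assembly (slotsOfRecord D ιr cc ag sg Pm 𝒵 domZ Jc Vv mI Lsl)).𝒯 (coresRec D Pm 𝒵 domZ Jc Vv mI Lsl) i n).q (op : OpDatum _) p v).re))
    (hH : ∀ k, ∀ g ∈ W, ∀ U : D.carriers.BgB, ‖(assembly (slotsOfRecord D ιr cc ag sg Pm 𝒵 domZ Jc Vv mI Lsl)).histRef g U k‖ + RHist k ≤ H k)
    -- the stripped majorant's decay split and anchored exponential norm
    (hκ : 0 ≤ κ) (hA0' : ∀ k Z ℓ, 0 ≤ A' k Z ℓ)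
    (hdecM : ∀ k Z ℓ, factorMass (coresRec D Pm 𝒵 domZ Jc Vv mI Lsl) N₀f bf mstar (H k) Z ℓ ≤ A' k Z ℓ * Real.exp (-(κ * (D.carriers.d Z + 5))))
    (hΦ0 : 0 ≤ Φ') (hsmallΦ : 36 * Φ' < 1)
    (hΦ' : ∀ (k : ℕ) (q : SCube D.toTwoRuns), ∑ Z ∈ D.toTwoRuns.domAt k,
      ind (q ∈ footprint Z) * actSum (b13InnerData D.toTwoRuns) (A' k) k Z * Real.exp ((footprint Z).card) ≤ Φ')
    -- sizes, the prescribed rate, the two strict size inequalities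
    (hE₀ : 0 ≤ E₀) (hcA : 0 ≤ cA) (hcB : 0 ≤ cB) (hr₀ : 0 < r₀) (hδ' : 0 ≤ δ')
    (hθθ' : Real.sqrt (max θ ((L : ℝ)⁻¹)) ≤ θ') (hθ'1 : θ' ≤ 1) (hω : 0 < Lsl.ins.ω) (hω1 : Lsl.ins.ω < 1)
    (hh : cA * (EA₀ + E₀) < 1 - Lsl.ins.ω)
    (hsmall : Lsl.ins.ω + Φ' / (1 - 36 * Φ') * cA * (1 - Lsl.ins.ω) / (1 - Lsl.ins.ω - cA * (EA₀ + E₀)) < θ') :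
    ∃ C₅, NE5 (outA (slotsOfRecord D ιr cc ag sg Pm 𝒵 domZ Jc Vv mI Lsl) E₀ cB)
      (outB (slotsOfRecord D ιr cc ag sg Pm 𝒵 domZ Jc Vv mI Lsl) E₀ cB) W κ θ' C₅ :=
  exists_ne5_substrate_cores_actNorm D ιr cc ag sg Pm 𝒵 domZ Jc Vv mI Lsl hbdA hmQA hmRA hbdB hmQB hmRB iopAt hiopA E₀ cB
    hbB hbA hdA hdB hRA hRB
    (weightedEntrywiseRate_slotsOfRecord_balaban_ne3Shape D ιr cc ag sg Pm 𝒵 domZ Jc Vv mI Lsl L M a ha hL hd hreg hα hβ hC hNE3 ha' hαη hβη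
      hη hdec hcovA hcovB hdom₁ hΦ hΛ₂ hS₂ hdecΦ hΔA hΔB hdom₂ hΨ hΛ₃ hS₃ hdecΨ hΓA hΓB hdom₃ hΛ₄ hΛ₅ hQ hR)
    hfl hins hOp hroom hHist hm hmf hN₀ hNf hqf hH hκ hA0' hdecM hΦ0 hsmallΦ hΦ' hE₀ hcA hcB (c1_balaban_nonneg L a hC hΛ₄ hΛ₅) hr₀ hδ'
    (sqrt_rate_pos_lt_one L hL hNE3.rate_lt_one).1 (sqrt_rate_pos_lt_one L hL hNE3.rate_lt_one).2 hθθ' hθ'1 hω hω1 hh hsmall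

end Instance

end Summit.QuantumFields.BalabanUV.T4Continuum.B13AssemblyCoresEndSubstrateBalaban

end
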